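import Mathlib
import Summits.MatrixMultiplication.MatrixMultiplication.Theses.FourierTwoFamiliesModP
import Summits.MatrixMultiplication.MatrixMultiplication.Theorems.FourierTwoFamiliesModPCyclicReductionTransfer
import Summits.MatrixMultiplication.MatrixMultiplication.Theorems.PrimeTwoFamilies.Negative.Slices
import Summits.MatrixMultiplication.MatrixMultiplication.Theorems.FourierTwoFamiliesModPPrimeTwoFamiliesStubLift
import Summits.MatrixMultiplication.MatrixMultiplication.Theorems.FourierTwoFamiliesModPPrimeTwoFamiliesStubWords
import Summits.MatrixMultiplication.MatrixMultiplication.Theorems.FourierTwoFamiliesModPPrimeTwoFamiliesStubBookkeeping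
import Summits.MatrixMultiplication.MatrixMultiplication.Theorems.FourierTwoFamiliesModPPrimeTwoFamiliesLadderConverse
import Literature.Computability.AlgebraicComplexity.SimultaneousDoubleProduct

/-!
# `PrimeTwoFamilies ↔` the cyclic ladder conjecture (line `Sketch`, crux stmt-MatrixMultiplication-14308)

The deliverable of line `Sketch` (idea `ladder-zone-frame-cap` ∪ `sperner-tensorisation-ut-gadgets`) in
closed form: CKSU 2005 Conj. 4.7 with prime cyclic hosts (`FourierTwoFamiliesModP.PrimeTwoFamilies`) is
EQUIVALENT to the CYCLIC LADDER CONJECTURE — for every `ε > 0` and arbitrarily large `m` there is an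
ordered escape ladder in `ℤ/m` ((i) every class `X c ⊕ Y c` direct; (ii) for classes `p < q` every LOWER
cross difference `y' - x'` (`x' ∈ X p`, `y' ∈ Y q`) differs from every diagonal difference `y - x`
(`x ∈ X c`, `y ∈ Y c`)) with `r ≥ m^{1/2-ε}` classes of co-volume `|X c||Y c| ≥ m^{1-ε}`.

* `primeTwoFamiliesAt_of_cyclicLadder` (⇐, slice form): ladders give every slice `0 < δ ≤ 1` of the crux —
  the constant-sum lift (`stub_lift`: words `w : Fin L → Fin r` of one digit sum index an SDPP family of
  products in `(ℤ/m)^L`), the pigeonhole on digit sums (`stub_words`), the tree's carry-free transfer into a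
  Bertrand prime `p ≤ 2·3^L·m^L` (`Theorems.exists_prime_sdpp_of_addEquiv`, route support CyclicReduction),
  and the exponent bookkeeping (`stub_bookkeeping`: `ε = δ/8`, `L = ⌈16/δ⌉ + 1`, `n` pairs kept).
* `primeTwoFamilies_iff_cyclicLadder` (↔): with the converse `cyclicLadder_of_primeTwoFamilies` (an SDPP
  witness is a ladder in any order) and slice monotonicity (`PrimeTwoFamiliesAt.mono`) for `δ > 1`.

So the crux loses nothing in ladder form: ONE-DIRECTIONAL separation (a triangular constraint system,
constructible sequentially in the class order) in ONE cyclic group, with the class count `r` decoupled from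
any host bookkeeping.  CKSU Prop. 4.5 is the `r = 2` ladder `({0}, Kˣ) < (Kˣ, {0})`; the crux is the
regime `(log r, log |X c||Y c|) → (½, 1)·log m`.
-/

-- single-conjunct summit: the mandated namespace repeats `MatrixMultiplication` (summit = sub-problem).
set_option linter.dupNamespace false

namespace Summit.MatrixMultiplication.MatrixMultiplication.Theorems.PrimeTwoFamilies.LadderLift

open Finset
open Summit.MatrixMultiplication.MatrixMultiplication.Theses
open Summit.MatrixMultiplication.MatrixMultiplication.Theorems.PrimeTwoFamilies.Negative
open Literature.Computability.AlgebraicComplexity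

/-- **Ladders give the crux, slice by slice.**  If for every `ε > 0` there are arbitrarily large `m` and
ordered escape ladders in `ZMod m` with `m^{1/2-ε} ≤ r` classes of co-volume `m^{1-ε} ≤ |X c||Y c|`, then
every slice `0 < δ ≤ 1` of `PrimeTwoFamilies` holds.  Composition of the landed stubs of line `Sketch`:
choose `ε, L` by `stub_bookkeeping`; take a ladder level `m ≥ max m₀ 1`; pick the most popular digit sum
(`stub_words`); lift (`stub_lift`) and enumerate the words by `Fin N`; move into `ℤ/p` by
`exists_prime_sdpp_of_addEquiv`; keep the first `n` pairs. -/
theorem primeTwoFamiliesAt_of_cyclicLadder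
    (hC : ∀ ε : ℝ, 0 < ε → ∀ m₀ : ℕ, ∃ m ≥ m₀, ∃ r : ℕ, ∃ X Y : Fin r → Finset (ZMod m),
      ((∀ c : Fin r, ∀ x ∈ X c, ∀ x' ∈ X c, ∀ y ∈ Y c, ∀ y' ∈ Y c,
          (x - x') + (y - y') = 0 → x = x' ∧ y = y') ∧
        (∀ c p q : Fin r, p < q → ∀ x ∈ X c, ∀ y ∈ Y c, ∀ x' ∈ X p, ∀ y' ∈ Y q,
          y - x ≠ y' - x')) ∧
      (m : ℝ) ^ (1 / 2 - ε) ≤ (r : ℝ) ∧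
      ∀ c : Fin r, (m : ℝ) ^ (1 - ε) ≤ (((X c).card * (Y c).card : ℕ) : ℝ))
    {δ : ℝ} (hδ : 0 < δ) (hδ1 : δ ≤ 1) : PrimeTwoFamiliesAt δ := by
  classical
  intro n₀
  obtain ⟨ε, hε, L, hbook⟩ := stub_bookkeeping δ hδ hδ1
  obtain ⟨m₀, hm₀⟩ := hbook n₀
  obtain ⟨m, hm, r, X, Y, hLad, hr, hP⟩ := hC ε hε (max m₀ 1)
  have hm₀m : m₀ ≤ m := le_trans (le_max_left _ _) hm
  have hm1 : 1 ≤ m := le_trans (le_max_right _ _) hm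
  obtain ⟨S, hS⟩ := stub_words r L
  -- the word set and its enumeration
  set Wd : Finset (Fin L → Fin r) :=
    Finset.univ.filter (fun w : Fin L → Fin r => ∑ t, ((w t : ℕ)) = S) with hWd
  set N : ℕ := Wd.card with hN
  have hmemWd : ∀ w : Fin L → Fin r, w ∈ Wd → ∑ t, ((w t : ℕ)) = S := fun w hw => by
    rw [hWd, Finset.mem_filter] at hw
    exact hw.2
  let e : Wd ≃ Fin N := Wd.equivFin
  -- the lifted family, indexed by `Fin N`
  let A : Fin N → Finset (Fin L → ZMod m) :=
    fun i => Fintype.piFinset (fun t => X ((e.symm i : Fin L → Fin r) t))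
  let B : Fin N → Finset (Fin L → ZMod m) :=
    fun i => Fintype.piFinset (fun t => Y ((e.symm i : Fin L → Fin r) t))
  obtain ⟨hW1, hX1⟩ := stub_lift X Y hLad.1 hLad.2 L S
  have hWA : ∀ i : Fin N, ∀ a ∈ A i, ∀ a' ∈ A i, ∀ b ∈ B i, ∀ b' ∈ B i,
      (a - a') + (b - b') = 0 → a = a' ∧ b = b' :=
    fun i => hW1 _ (hmemWd _ (e.symm i).2)
  have hXA : ∀ i j k : Fin N, ∀ a ∈ A i, ∀ a' ∈ A j, ∀ b ∈ B j, ∀ b' ∈ B k,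
      (a - a') + (b - b') = 0 → i = k := by
    intro i j k a ha a' ha' b hb b' hb' h0
    have hik := hX1 _ _ _ (hmemWd _ (e.symm i).2) (hmemWd _ (e.symm j).2)
      (hmemWd _ (e.symm k).2) a ha a' ha' b hb b' hb' h0
    exact e.symm.injective (Subtype.ext hik)
  -- transfer into a prime cyclic host (tree: route support CyclicReduction, transfer step)
  obtain ⟨p, hp, hpR, A', B', hcard, hW', hX'⟩ :=
    exists_prime_sdpp_of_addEquiv hWA hXA (m := fun _ : Fin L => m) (fun _ => hm1)
      (AddEquiv.refl (Fin L → ZMod m))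
  rw [Fin.prod_const] at hpR
  -- the number of pairs kept
  obtain ⟨n, hn₀, hnN, hpn, hnP⟩ := hm₀ m hm₀m r hr N hS p hpR
  refine ⟨n, hn₀, p, hp, A' ∘ Fin.castLE hnN, B' ∘ Fin.castLE hnN, ?_, ?_, hpn, ?_⟩
  · intro i
    exact hW' (Fin.castLE hnN i)
  · intro i j k a ha a' ha' b hb b' hb' h0
    exact Fin.castLE_injective hnN (hX' _ _ _ a ha a' ha' b hb b' hb' h0)
  · intro i
    have hci := hcard (Fin.castLE hnN i)
    simp only [Function.comp_apply]
    rw [hci.1, hci.2]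
    simp only [A, B, Fintype.card_piFinset]
    rw [← Finset.prod_mul_distrib]
    refine hnP.trans ?_
    rw [← Fin.prod_const]
    push_cast
    refine Finset.prod_le_prod (fun t _ => by positivity) fun t _ => ?_
    exact_mod_cast hP _

/-- **`PrimeTwoFamilies ↔` the cyclic ladder conjecture** (line `Sketch`, crux
stmt-MatrixMultiplication-14308): CKSU Conj. 4.7 with prime cyclic hosts holds iff for every `ε > 0`
there are arbitrarily large `m` and ordered escape ladders in `ZMod m` — (i) every class direct, (ii)
lower cross differences (`p < q`) avoiding all diagonal differences — with `m^{1/2-ε} ≤ r` classes of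
co-volume `m^{1-ε} ≤ |X c||Y c|`.  (⇒) `cyclicLadder_of_primeTwoFamilies` (an SDPP witness is a ladder in
any order); (⇐) `primeTwoFamiliesAt_of_cyclicLadder` for `δ ≤ 1` and slice monotonicity above. -/
theorem primeTwoFamilies_iff_cyclicLadder :
    FourierTwoFamiliesModP.PrimeTwoFamilies ↔
    (∀ ε : ℝ, 0 < ε → ∀ m₀ : ℕ, ∃ m ≥ m₀, ∃ r : ℕ, ∃ X Y : Fin r → Finset (ZMod m),
      ((∀ c : Fin r, ∀ x ∈ X c, ∀ x' ∈ X c, ∀ y ∈ Y c, ∀ y' ∈ Y c,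
          (x - x') + (y - y') = 0 → x = x' ∧ y = y') ∧
        (∀ c p q : Fin r, p < q → ∀ x ∈ X c, ∀ y ∈ Y c, ∀ x' ∈ X p, ∀ y' ∈ Y q,
          y - x ≠ y' - x')) ∧
      (m : ℝ) ^ (1 / 2 - ε) ≤ (r : ℝ) ∧
      ∀ c : Fin r, (m : ℝ) ^ (1 - ε) ≤ (((X c).card * (Y c).card : ℕ) : ℝ)) := by
  refine ⟨cyclicLadder_of_primeTwoFamilies, fun hC => ?_⟩
  rw [primeTwoFamilies_iff]
  intro δ hδ
  by_cases h1 : δ ≤ 1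
  · exact primeTwoFamiliesAt_of_cyclicLadder hC hδ h1
  · exact (primeTwoFamiliesAt_of_cyclicLadder hC one_pos le_rfl).mono (le_of_not_ge h1)

end Summit.MatrixMultiplication.MatrixMultiplication.Theorems.PrimeTwoFamilies.LadderLift
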